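import Literature.NumberTheory.EllipticCurves.PAdicLFunctionPlusMult
import Literature.NumberTheory.EllipticCurves.PAdicLFunctionMinusMultDistributionProofs
import HarnessLib

/-!
# The one-term PLUS measure at `p ∣ N`: distribution law and the constant terms of its `ω^i`-branches
# `L⁺_p(f, a_p, ω^i, 0) = a_p⁻¹ · ∑_{a mod p} ω(a)^i [a/p]⁺_f` (theorems; sibling of `PAdicLFunctionPlusMult`)

Topic `NumberTheory/EllipticCurves`; namespace `Literature.NumberTheory.EllipticCurves`. THEOREMS
only (no `def`, no `sorry`, no named fact). Plus twins of `PAdicLFunctionMinusMultDistributionProofs`: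

* `sum_fiber_msdPlusMeasureMult_succ_eq[_of_coeffField]` — the distribution law of
  `μ⁺ = msdPlusMeasureMult f a_p` at `p ∣ N` (Mazur–Tate–Teitelbaum 1986 §I.10 (10.2) with
  `ε(p) = 0`), from the `U_p`-relation for the rational plus symbols
  (`intCast_mul_ratPlusSymbol_of_dvd`; rationality `ratCast_ratPlusSymbol_holds`);
* `padicLPlusBranchMultRiemannSum_zero_eq`, `padicLPlusBranchMultCoeff_zero_eq`,
  `constantCoeff_padicLFunctionPlusBranchMult_eq` — the constant term of the `ω^i`-branch is the
  fixed finite sum `∑_{a ∈ (ℤ/p^{e₀})ˣ} μ⁺(a + p^{e₀}ℤ_p) ω(a)^i`;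
* `constantCoeff_padicLFunctionPlusBranchMult_eq_sum` — for `p` odd the one-term measure has NO
  second term, so for EVERY `i`: `L⁺_p(f, α, ω^i, 0) = α⁻¹ · ∑_{a ∈ (ℤ/p)ˣ} ω(a)^i [a/p]⁺_f`.

References: Mazur–Tate–Teitelbaum 1986 [MazurTateTeitelbaum1986Invent] §I.4 (4.2), §I.10 (10.1)–(10.2),
§I.13. Motivation: line V19b of the cell `b2b-bsdres` (module docstring of `PAdicLFunctionPlusMult`).
-/

noncomputable section

open scoped MatrixGroups ModularForm

open CongruenceSubgroup Filter Topology Literature.NumberTheory.EllipticCurves.ModularForms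

namespace Literature.NumberTheory.EllipticCurves

/-! ### The distribution law of the one-term plus measure -/

section PlusMultDistribution

variable {N : ℕ} [NeZero N] {p : ℕ} [Fact p.Prime]

/-- **The distribution law of `μ⁺_{f,a_p}` at `p ∣ N`** (MTT §I.10 (10.2), `ε(p) = 0`): for a newform
`f` of level `N`, `p ∣ N`, rational plus symbols (`hrat`), `a_p(f) = a_p ∈ ℤ` non-zero in `ℚ_p`,
`∑_{b ≡ a mod pⁿ} μ⁺(b + pⁿ⁺¹ℤ_p) = μ⁺(a + pⁿℤ_p)` for `μ⁺ = msdPlusMeasureMult f a_p`: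
`∑_j a_p⁻⁽ⁿ⁺¹⁾[(x + j)/p]⁺ = a_p⁻⁽ⁿ⁺¹⁾ · a_p [x]⁺ = a_p⁻ⁿ [x]⁺` by the `U_p`-relation.
[cite: MazurTateTeitelbaum1986Invent, §I.10 Prop. (10.2) with ε(p) = 0] -/
theorem sum_fiber_msdPlusMeasureMult_succ_eq {f : CuspForm (Gamma0 N) 2}
    (hrat : ∀ r : ℚ, (ratPlusSymbol f r : ℝ) = normalizedPlusSymbol f r) (hf : IsNewform0 f)
    (hpN : p ∣ N) {ap : ℤ} (hap : cuspCoeff f p = ap) (hap0 : (ap : ℚ_[p]) ≠ 0)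
    (n : ℕ) (a : ZMod (p ^ n)) :
    ∑ b ∈ Finset.univ.filter (fun b : ZMod (p ^ (n + 1)) ↦
        ZMod.castHom (pow_dvd_pow p n.le_succ) (ZMod (p ^ n)) b = a),
      msdPlusMeasureMult f (ap : ℚ_[p]) (n + 1) b = msdPlusMeasureMult f (ap : ℚ_[p]) n a := by
  classical
  haveI : NeZero p := ⟨(Fact.out : p.Prime).ne_zero⟩
  have hp : p.Prime := Fact.out
  have hp0 : (p : ℚ) ≠ 0 := by exact_mod_cast hp.ne_zero
  have hinj : Function.Injective
      (fun j : Fin p ↦ ((a.val + p ^ n * (j : ℕ) : ℕ) : ZMod (p ^ (n + 1)))) := by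
    intro j j' h
    have hv := congr_arg ZMod.val h
    simp only [val_classLift] at hv
    exact Fin.ext (Nat.eq_of_mul_eq_mul_left (pow_pos hp.pos n) (by omega))
  rw [filter_castHom_eq_image, Finset.sum_image fun j _ j' _ h ↦ hinj h]
  set x : ℚ := (a.val : ℚ) / (p : ℚ) ^ n with hx
  have hA : ∀ j : Fin p, ((a.val + p ^ n * (j : ℕ) : ℕ) : ℚ) / (p : ℚ) ^ (n + 1) = (x + j) / p := by
    intro j
    rw [hx]
    push_cast
    field_simp
    ring
  have hHecke := intCast_mul_ratPlusSymbol_of_dvd p hf hp hpN hap hrat x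
  have hsum : ∑ j : Fin p,
      msdPlusMeasureMult f (ap : ℚ_[p]) (n + 1) ((a.val + p ^ n * (j : ℕ) : ℕ) : ZMod (p ^ (n + 1))) =
      (ap : ℚ_[p])⁻¹ ^ (n + 1) * ((ap : ℚ_[p]) * (ratPlusSymbol f x : ℚ_[p])) := by
    calc _ = ∑ j : Fin p, (ap : ℚ_[p])⁻¹ ^ (n + 1) * (ratPlusSymbol f ((x + j) / p) : ℚ_[p]) := by
          refine Finset.sum_congr rfl fun j _ ↦ ?_
          simp only [msdPlusMeasureMult, val_classLift, hA]
      _ = (ap : ℚ_[p])⁻¹ ^ (n + 1) * ((∑ j : Fin p, ratPlusSymbol f ((x + j) / p) : ℚ) : ℚ_[p]) := by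
          rw [← Finset.mul_sum, Rat.cast_sum]
      _ = _ := by
          rw [← hHecke]
          push_cast
          ring
  rw [hsum]
  simp only [msdPlusMeasureMult]
  rw [← hx, pow_succ]
  field_simp

/-- **The distribution law of `μ⁺_{f,a_p}` at `p ∣ N` for a RATIONAL NEWFORM, unconditionally** (the
rationality input is the tree's `ratCast_ratPlusSymbol_holds`, Manin–Drinfeld).
[cite: MazurTateTeitelbaum1986Invent, §I.10 Prop. (10.2) with ε(p) = 0] -/
theorem sum_fiber_msdPlusMeasureMult_succ_eq_of_coeffField {f : CuspForm (Gamma0 N) 2}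
    (hf : IsNewform0 f) (hQ : coeffField f = ⊥)
    (hpN : p ∣ N) {ap : ℤ} (hap : cuspCoeff f p = ap) (hap0 : (ap : ℚ_[p]) ≠ 0)
    (n : ℕ) (a : ZMod (p ^ n)) :
    ∑ b ∈ Finset.univ.filter (fun b : ZMod (p ^ (n + 1)) ↦
        ZMod.castHom (pow_dvd_pow p n.le_succ) (ZMod (p ^ n)) b = a),
      msdPlusMeasureMult f (ap : ℚ_[p]) (n + 1) b = msdPlusMeasureMult f (ap : ℚ_[p]) n a :=
  sum_fiber_msdPlusMeasureMult_succ_eq (ratCast_ratPlusSymbol_holds hf hQ) hf hpN hap hap0 n a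

end PlusMultDistribution

/-! ### The constant term of the `ω^i`-branches of the one-term plus measure -/

section PlusMultConstantTerm

variable {p : ℕ} [Fact p.Prime] {N : ℕ} {f : CuspForm (Gamma0 N) 2} {α : ℚ_[p]}

/-- **The Riemann sums for the constant term of the `ω^i`-branch are a fixed finite sum at level
`p^{e₀}`**: `padicLPlusBranchMultRiemannSum f α i 0 n = ∑_{a ∈ (ℤ/p^{e₀})ˣ} μ⁺(a + p^{e₀}ℤ_p) · ω(a)^i`,
granted the distribution law of `μ⁺ = msdPlusMeasureMult f α` (`hdist`). Verbatim
`padicLMinusBranchMultRiemannSum_zero_eq` with the plus measure. [cite: MazurTateTeitelbaum1986Invent, §I.13] -/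
theorem padicLPlusBranchMultRiemannSum_zero_eq
    (hdist : ∀ (n : ℕ) (a : ZMod (p ^ n)),
      ∑ b ∈ Finset.univ.filter (fun b : ZMod (p ^ (n + 1)) ↦
        ZMod.castHom (pow_dvd_pow p n.le_succ) (ZMod (p ^ n)) b = a), msdPlusMeasureMult f α (n + 1) b =
        msdPlusMeasureMult f α n a)
    (i n : ℕ) :
    padicLPlusBranchMultRiemannSum f α i 0 n =
      ∑ a : (ZMod (p ^ cyclotomicExponent p))ˣ,
        msdPlusMeasureMult f α (cyclotomicExponent p) a *
          ((((teichRep p a : rootsOfUnity (torsionOrder p) ℤ_[p]) : ℤ_[p]ˣ) : ℤ_[p]) : ℚ_[p]) ^ i := by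
  classical
  have hle : cyclotomicExponent p ≤ n + cyclotomicExponent p := Nat.le_add_left _ _
  have he : 1 ≤ cyclotomicExponent p := Nat.pos_of_ne_zero (cyclotomicExponent_ne_zero p)
  set G : ZMod (p ^ (n + cyclotomicExponent p)) → ℚ_[p] := fun u ↦
    RingHom.id ℚ_[p] (msdPlusMeasureMult f α (n + cyclotomicExponent p) u) *
      teichWeight p i (ZMod.castHom (pow_dvd_pow p hle) (ZMod (p ^ cyclotomicExponent p)) u) with hG
  have h1 : padicLPlusBranchMultRiemannSum f α i 0 n =
      ∑ᶠ ζ : rootsOfUnity (torsionOrder p) ℤ_[p], ∑ s : ZMod (p ^ n),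
        G (PadicInt.toZModPow (n + cyclotomicExponent p) ((ζ : ℤ_[p]ˣ) : ℤ_[p]) *
          (cyclotomicGenerator p : ZMod (p ^ (n + cyclotomicExponent p))) ^ s.val) := by
    unfold padicLPlusBranchMultRiemannSum
    refine finsum_congr fun ζ ↦ Finset.sum_congr rfl fun s _ ↦ ?_
    rw [hG]
    dsimp only
    rw [RingHom.id_apply, teichWeight_classMap p i n ζ s, Nat.choose_zero_right, Nat.cast_one,
      mul_one, mul_comm]
  rw [h1, finsum_sum_classes_eq_sum_units p n G]
  have h2 := sum_units_mul_of_distribution (μ := msdPlusMeasureMult f α) hdist (RingHom.id ℚ_[p]) he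
    hle (teichWeight p i)
  rw [hG]
  dsimp only
  rw [h2]
  refine Finset.sum_congr rfl fun a _ ↦ ?_
  rw [RingHom.id_apply, teichWeight_units]

/-- **The constant term of the `ω^i`-branch of the one-term plus measure**:
`padicLPlusBranchMultCoeff f α i 0 = ∑_{a ∈ (ℤ/p^{e₀})ˣ} μ⁺(a + p^{e₀}ℤ_p) · ω(a)^i`.
[cite: MazurTateTeitelbaum1986Invent, §I.13] -/
theorem padicLPlusBranchMultCoeff_zero_eq
    (hdist : ∀ (n : ℕ) (a : ZMod (p ^ n)),
      ∑ b ∈ Finset.univ.filter (fun b : ZMod (p ^ (n + 1)) ↦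
        ZMod.castHom (pow_dvd_pow p n.le_succ) (ZMod (p ^ n)) b = a), msdPlusMeasureMult f α (n + 1) b =
        msdPlusMeasureMult f α n a)
    (i : ℕ) :
    padicLPlusBranchMultCoeff f α i 0 =
      ∑ a : (ZMod (p ^ cyclotomicExponent p))ˣ,
        msdPlusMeasureMult f α (cyclotomicExponent p) a *
          ((((teichRep p a : rootsOfUnity (torsionOrder p) ℤ_[p]) : ℤ_[p]ˣ) : ℤ_[p]) : ℚ_[p]) ^ i := by
  unfold padicLPlusBranchMultCoeff
  exact (tendsto_const_nhds.congr fun n ↦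
    (padicLPlusBranchMultRiemannSum_zero_eq hdist i n).symm).limUnder_eq

/-- **The constant term of `L⁺_p(f, α, ω^i, T)` at `p ∣ N` as a power series**:
`constantCoeff (padicLFunctionPlusBranchMult f α i) = ∑_{a ∈ (ℤ/p^{e₀})ˣ} μ⁺(a + p^{e₀}ℤ_p) ω(a)^i`.
[cite: MazurTateTeitelbaum1986Invent, §I.13] -/
theorem constantCoeff_padicLFunctionPlusBranchMult_eq
    (hdist : ∀ (n : ℕ) (a : ZMod (p ^ n)),
      ∑ b ∈ Finset.univ.filter (fun b : ZMod (p ^ (n + 1)) ↦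
        ZMod.castHom (pow_dvd_pow p n.le_succ) (ZMod (p ^ n)) b = a), msdPlusMeasureMult f α (n + 1) b =
        msdPlusMeasureMult f α n a)
    (i : ℕ) :
    PowerSeries.constantCoeff (padicLFunctionPlusBranchMult f α i) =
      ∑ a : (ZMod (p ^ cyclotomicExponent p))ˣ,
        msdPlusMeasureMult f α (cyclotomicExponent p) a *
          ((((teichRep p a : rootsOfUnity (torsionOrder p) ℤ_[p]) : ℤ_[p]ˣ) : ℤ_[p]) : ℚ_[p]) ^ i := by
  rw [constantCoeff_padicLFunctionPlusBranchMult, padicLPlusBranchMultCoeff_zero_eq hdist]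

/-- **The constant term as an explicit modular-symbol sum, every `i`, `p` odd**: the one-term
measure of a class mod `p` is `α⁻¹[a/p]⁺` (no second term since `ε(p) = 0`), so
`L⁺_p(f, α, ω^i, 0) = α⁻¹ · ∑_{a ∈ (ℤ/p)ˣ} ω(a)^i [a/p]⁺_f` (granted the distribution law `hdist`).
[cite: MazurTateTeitelbaum1986Invent, §I.13–I.14 with (10.1), ε(p) = 0] -/
theorem constantCoeff_padicLFunctionPlusBranchMult_eq_sum (hp2 : p ≠ 2)
    (hdist : ∀ (n : ℕ) (a : ZMod (p ^ n)),
      ∑ b ∈ Finset.univ.filter (fun b : ZMod (p ^ (n + 1)) ↦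
        ZMod.castHom (pow_dvd_pow p n.le_succ) (ZMod (p ^ n)) b = a), msdPlusMeasureMult f α (n + 1) b =
        msdPlusMeasureMult f α n a)
    (i : ℕ) :
    PowerSeries.constantCoeff (padicLFunctionPlusBranchMult f α i) =
      α⁻¹ * ∑ a : (ZMod (p ^ cyclotomicExponent p))ˣ,
        ((((teichRep p a : rootsOfUnity (torsionOrder p) ℤ_[p]) : ℤ_[p]ˣ) : ℤ_[p]) : ℚ_[p]) ^ i *
          (ratPlusSymbol f (((a : ZMod (p ^ cyclotomicExponent p)).val : ℚ) / p) : ℚ_[p]) := by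
  classical
  have he : cyclotomicExponent p = 1 := by
    rw [cyclotomicExponent, if_neg hp2]
  rw [constantCoeff_padicLFunctionPlusBranchMult_eq hdist i, Finset.mul_sum]
  refine Finset.sum_congr rfl fun a _ ↦ ?_
  simp only [msdPlusMeasureMult, he, pow_one]
  ring

end PlusMultConstantTerm

end Literature.NumberTheory.EllipticCurves

end
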